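import Mathlib
import Summits.SmoothPoincare4.SmoothPoincare4.Theorems.CylinderEntropyCylinderRungTwoKCertSoundArith
import Summits.SmoothPoincare4.SmoothPoincare4.Theorems.CylinderEntropySliceIsolationCertEnvelope
import Literature.Geometry.Riemannian.SphericalZonalGaussianBounds
import Literature.Geometry.Riemannian.SphericalZonalSixPositivity
import HarnessLib

/-!
# Kernel certificate checker for `stub_certMid`, IV: soundness of atoms, grid and tables

Infrastructure file 4 for the kernel-clean discharge of the registered stub `stub_certMid` of crux
stmt-SmoothPoincare4-7631 (`Summit.SmoothPoincare4.SmoothPoincare4.Theses.CylinderEntropy.CylinderRungTwo`, line `killing-flux`).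
Proved here, for a validated atom `a` (`KCert.atomOK`) and a validated grid (`KCert.gridOK`):

* `atomOK_sound`, `gridOK_sound` — the real facts behind the Boolean validations (`0 < q < 1`, `tlo ≤ τ ≤ thi`, the grid angles
  `θ_i = arccos s_i ∈ [tlo_i, thi_i]`, `θ_0 = 0`, `θ_{N} = π`, strict monotonicity);
* Hamilton's convex function `f(θ) = log zonal(τ, cos θ) + θ²/(4τ)` of the atom: differentiability (`hasDerivAt_f`), the tangent
  inequality (`f_tangent`), the monotonicity of `f'` (`fd_mono`), `f'(0) = 0`, `f'(π) = π/(2τ)`;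
* `rawTab_spec` — the rounded two-sided zonal values bracket `zonal(τ, s_i)`;
* `mloEff_spec`, `mhiEff_spec` — the EFFECTIVE slope data satisfy `0 ≤ mlo ≤ f'(θ_i) ≤ mhi` (verified secants or fallbacks);
* `tangent_lower` — the tangent-form minorant `log zlo_i + mlo (θ - θ_i) - (θ² - θ_i²)/(4τ) ≤ log zonal(τ, cos θ)` for `θ ≥ θ_i`,
  and its consequences `cello_le` (lower bound on a grid cell) and `exp_f_le_expf` (upper bound of `e^{f(θ_i)}`).
No new definitions of mathematical content (only abbreviations of real quantities), no named facts.
-/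

-- the registered namespace `Summit.SmoothPoincare4.SmoothPoincare4.…` repeats a component
set_option linter.dupNamespace false

noncomputable section

namespace Summit.SmoothPoincare4.SmoothPoincare4.Cruxes.CylinderRungTwo.KillingFlux

namespace KCert

open Set
open Summit.SmoothPoincare4.SmoothPoincare4.Theorems.CylinderEntropySliceIsolation.Cert
open Literature.Geometry.Riemannian.SphericalCylinderEntropy
  Literature.Geometry.Riemannian.SphericalZonalKernelSeries

/-! ### Real quantities attached to the data -/

/-- The real scale `τ = -log(q)/2` of an atom. [folklore] -/
def KAtom.tau (a : KAtom) : ℝ := -(Real.log (a.q : ℝ)) / 2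

/-- The zonal factor of an atom as a function of the angle `θ`. [folklore] -/
def KAtom.Zc (a : KAtom) (θ : ℝ) : ℝ := zonal a.tau (Real.cos θ)

/-- Hamilton's convex function `f(θ) = log zonal(τ, cos θ) + θ²/(4τ)` of an atom. [folklore] -/
def KAtom.f (a : KAtom) (θ : ℝ) : ℝ := Real.log (zonal a.tau (Real.cos θ)) + θ ^ 2 / (4 * a.tau)

/-- Its derivative `f'(θ)`. [folklore] -/
def KAtom.fd (a : KAtom) (θ : ℝ) : ℝ :=
  deriv (fun x => Real.log (zonal a.tau (Real.cos x))) θ + θ / (2 * a.tau)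

/-- The real grid angle `θ_i = arccos s_i`. [folklore] -/
def GridPt.theta (g : GridPt) : ℝ := Real.arccos (g.s : ℝ)

/-! ### Atoms -/

variable (C : KCell)

/-- A validated atom: `0 < q < 1`, `0 ≤ w`, `0 < tlo ≤ τ ≤ thi`, and the sharp-tail condition. [folklore] -/
theorem atomOK_sound {a : KAtom} (h : atomOK C a = true) :
    0 < a.q ∧ a.q < 1 ∧ 0 ≤ a.w ∧ 0 < a.tlo ∧ (a.tlo : ℝ) ≤ a.tau ∧ a.tau ≤ (a.thi : ℝ) ∧ sharpOK a.q a.K = true := by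
  simp only [atomOK, Bool.and_eq_true, decide_eq_true_eq] at h
  obtain ⟨⟨⟨⟨⟨⟨⟨hq0, hq1⟩, hw⟩, ht⟩, _⟩, hqe⟩, hqe'⟩, hsharp⟩ := h
  refine ⟨hq0, hq1, hw, ht, ?_, ?_, hsharp⟩
  · have h1 : ((a.q : ℚ) : ℝ) ≤ Real.exp (-2 * (a.tlo : ℝ)) := by
      have := expLo_le (-2 * a.tlo) C.prec
      push_cast at this
      exact le_trans (by exact_mod_cast hqe) this
    exact le_neg_log_div_two _ _ (by exact_mod_cast hq0) h1
  · have h1 : Real.exp (-2 * (a.thi : ℝ)) ≤ ((a.q : ℚ) : ℝ) := by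
      have := exp_le_expHi (-2 * a.thi) C.prec
      push_cast at this
      exact le_trans this (by exact_mod_cast hqe')
    exact neg_log_div_two_le _ _ (by exact_mod_cast hq0) h1

/-- `0 < τ` for a validated atom. [folklore] -/
theorem tau_pos {a : KAtom} (h : atomOK C a = true) : 0 < a.tau := by
  obtain ⟨_, _, _, ht, htl, _⟩ := atomOK_sound C h
  exact lt_of_lt_of_le (by exact_mod_cast ht) htl

/-- `0 < Zc` everywhere. [folklore] -/
theorem Zc_pos {a : KAtom} (h : atomOK C a = true) (θ : ℝ) : 0 < a.Zc θ :=
  zonal_cos_pos (tau_pos C h) θ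

/-! ### Hamilton's convex function of an atom -/

/-- `f` is the convex function of `convexOn_log_zonal_cos`. [folklore] -/
theorem convexOn_f {a : KAtom} (h : atomOK C a = true) : ConvexOn ℝ univ a.f := by
  have := convexOn_log_zonal_cos (tau_pos C h)
  exact this

/-- `f` has derivative `fd`. [folklore] -/
theorem hasDerivAt_f {a : KAtom} (h : atomOK C a = true) (θ : ℝ) : HasDerivAt a.f (a.fd θ) θ := by
  have hτ := tau_pos C h
  have hD : HasDerivAt (fun x => Real.log (zonal a.tau (Real.cos x)))
      (deriv (fun x => Real.log (zonal a.tau (Real.cos x))) θ) θ :=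
    (hasDerivAt_log_zonal_cos hτ θ).differentiableAt.hasDerivAt
  have hτ0 : a.tau ≠ 0 := hτ.ne'
  have h2 : HasDerivAt (fun x : ℝ => x ^ 2 / (4 * a.tau)) (θ / (2 * a.tau)) θ := by
    have h := (hasDerivAt_pow 2 θ).div_const (4 * a.tau)
    have e : ((2 : ℕ) : ℝ) * θ ^ (2 - 1) / (4 * a.tau) = θ / (2 * a.tau) := by
      rw [show (2 : ℕ) - 1 = 1 from rfl, pow_one]
      push_cast
      field_simp
      ring
    rw [e] at h
    exact h
  exact hD.add h2

/-- The tangent inequality `f θ₀ + f'(θ₀) (θ - θ₀) ≤ f θ`. [folklore] -/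
theorem f_tangent {a : KAtom} (h : atomOK C a = true) (θ₀ θ : ℝ) : a.f θ₀ + a.fd θ₀ * (θ - θ₀) ≤ a.f θ :=
  convexOn_univ_tangent_line_le (convexOn_f C h) (hasDerivAt_f C h θ₀) θ

/-- `f'` is monotone (convexity). [folklore] -/
theorem fd_mono {a : KAtom} (h : atomOK C a = true) {x y : ℝ} (hxy : x ≤ y) : a.fd x ≤ a.fd y := by
  rcases eq_or_lt_of_le hxy with rfl | hlt
  · exact le_rfl
  have hconv := convexOn_f C h
  have h1 : a.fd x ≤ slope a.f x y := hconv.le_slope_of_hasDerivAt (mem_univ x) (mem_univ y) hlt (hasDerivAt_f C h x)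
  have h2 : slope a.f x y ≤ a.fd y := hconv.slope_le_of_hasDerivAt (mem_univ x) (mem_univ y) hlt (hasDerivAt_f C h y)
  exact h1.trans h2

/-- `f'(0) = 0`. [folklore] -/
theorem fd_zero {a : KAtom} (h : atomOK C a = true) : a.fd 0 = 0 := by
  unfold KAtom.fd
  rw [deriv_log_zonal_cos (tau_pos C h)]
  simp

/-- `f'(π) = π/(2τ)`. [folklore] -/
theorem fd_pi {a : KAtom} (h : atomOK C a = true) : a.fd Real.pi = Real.pi / (2 * a.tau) := by
  unfold KAtom.fd
  rw [deriv_log_zonal_cos (tau_pos C h)]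
  simp

/-- `0 ≤ f'(θ)` for `0 ≤ θ`. [folklore] -/
theorem fd_nonneg {a : KAtom} (h : atomOK C a = true) {θ : ℝ} (hθ : 0 ≤ θ) : 0 ≤ a.fd θ := by
  rw [← fd_zero C h]; exact fd_mono C h hθ

/-- `f'(θ) ≤ π/(2τ)` for `θ ≤ π`. [folklore] -/
theorem fd_le_pi {a : KAtom} (h : atomOK C a = true) {θ : ℝ} (hθ : θ ≤ Real.pi) : a.fd θ ≤ Real.pi / (2 * a.tau) := by
  rw [← fd_pi C h]; exact fd_mono C h hθ

/-- The log of the zonal factor in terms of `f`. [folklore] -/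
theorem log_Zc_eq {a : KAtom} (θ : ℝ) : Real.log (a.Zc θ) = a.f θ - θ ^ 2 / (4 * a.tau) := by
  unfold KAtom.f KAtom.Zc; ring

/-- **Tangent-form minorant of the zonal factor**: for `θ₀ ≤ θ` and any `m ≤ f'(θ₀)`,
`log Zc θ₀ + m (θ - θ₀) - (θ² - θ₀²)/(4τ) ≤ log Zc θ`. [folklore] -/
theorem log_Zc_tangent {a : KAtom} (h : atomOK C a = true) {θ₀ θ m : ℝ} (hle : θ₀ ≤ θ) (hm : m ≤ a.fd θ₀) :
    Real.log (a.Zc θ₀) + m * (θ - θ₀) - (θ ^ 2 - θ₀ ^ 2) / (4 * a.tau) ≤ Real.log (a.Zc θ) := by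
  have ht := f_tangent C h θ₀ θ
  rw [log_Zc_eq, log_Zc_eq]
  have : m * (θ - θ₀) ≤ a.fd θ₀ * (θ - θ₀) := mul_le_mul_of_nonneg_right hm (sub_nonneg.2 hle)
  have key : θ₀ ^ 2 / (4 * a.tau) + (θ ^ 2 - θ₀ ^ 2) / (4 * a.tau) = θ ^ 2 / (4 * a.tau) := by ring
  linarith

/-- **End-point majorant**: for `θ ∈ [x, y]`, `f θ ≤ max (f x) (f y)` (convexity). [folklore] -/
theorem f_le_max {a : KAtom} (h : atomOK C a = true) {x y θ : ℝ} (hx : x ≤ θ) (hy : θ ≤ y) :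
    a.f θ ≤ max (a.f x) (a.f y) :=
  (convexOn_f C h).le_on_segment (mem_univ x) (mem_univ y) (by rw [segment_eq_Icc (hx.trans hy)]; exact ⟨hx, hy⟩)

/-- The zonal factor is non-increasing in `θ ∈ [0, π]` (the kernel increases in `s = cos θ`). [folklore] -/
theorem Zc_antitone {a : KAtom} (h : atomOK C a = true) {x y : ℝ} (hx : 0 ≤ x) (hxy : x ≤ y) (hy : y ≤ Real.pi) :
    a.Zc y ≤ a.Zc x := by
  unfold KAtom.Zc
  exact monotoneOn_zonal (tau_pos C h) ⟨Real.neg_one_le_cos y, Real.cos_le_one y⟩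
    ⟨Real.neg_one_le_cos x, Real.cos_le_one x⟩ (Real.cos_le_cos_of_nonneg_of_le_pi hx hy hxy)

/-! ### The grid -/

/-- A validated interior grid point: `-1 ≤ s ≤ 1`, `0 ≤ tlo ≤ θ ≤ thi < πlo`. [folklore] -/
theorem gridPtOK_sound {g : GridPt} (h : gridPtOK g = true) :
    -1 ≤ g.s ∧ g.s ≤ 1 ∧ 0 ≤ g.tlo ∧ (g.tlo : ℝ) ≤ g.theta ∧ g.theta ≤ (g.thi : ℝ) ∧ g.thi < piLo := by
  simp only [gridPtOK, Bool.and_eq_true, decide_eq_true_eq] at h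
  obtain ⟨⟨⟨⟨⟨⟨ht0, htt⟩, htp⟩, hs1⟩, hs2⟩, hc1⟩, hc2⟩ := h
  have htlo0 : (0 : ℝ) ≤ g.tlo := by exact_mod_cast ht0
  have hthi0 : (0 : ℚ) ≤ g.thi := ht0.trans htt
  have hthiπ : ((g.thi : ℚ) : ℝ) ≤ Real.pi := by
    have : ((g.thi : ℚ) : ℝ) < ((piLo : ℚ) : ℝ) := by exact_mod_cast htp
    linarith [piLo_lt_pi]
  have htloπ : ((g.tlo : ℚ) : ℝ) ≤ Real.pi := le_trans (by exact_mod_cast htt) hthiπ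
  refine ⟨hs1, hs2, ht0, ?_, ?_, htp⟩
  · -- `s S ≤ ⌈s S⌉ ≤ (cosI tlo).lo ≤ cos tlo · S` ⇒ `s ≤ cos tlo` ⇒ `tlo = arccos (cos tlo) ≤ arccos s`
    have hcs : ((g.s : ℚ) : ℝ) ≤ Real.cos (g.tlo : ℝ) := by
      have h1 := le_zhi64 g.s
      have h2 := (cosI_spec ht0 htloπ).1
      have h3 : ((zhi64 g.s : ℤ) : ℝ) ≤ (((cosI g.tlo).lo : ℤ) : ℝ) := by exact_mod_cast hc2
      exact le_of_mul_le_mul_right (h1.trans (h3.trans h2)) S64_cast_pos.2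
    have := Real.antitone_arccos hcs
    rwa [Real.arccos_cos htlo0 htloπ] at this
  · have hcs : Real.cos (g.thi : ℝ) ≤ ((g.s : ℚ) : ℝ) := by
      have h1 := zlo64_le g.s
      have h2 := (cosI_spec hthi0 hthiπ).2
      have h3 : (((cosI g.thi).hi : ℤ) : ℝ) ≤ ((zlo64 g.s : ℤ) : ℝ) := by exact_mod_cast hc1
      exact le_of_mul_le_mul_right (h2.trans (h3.trans h1)) S64_cast_pos.2
    have := Real.antitone_arccos hcs
    rwa [Real.arccos_cos (by exact_mod_cast hthi0) hthiπ] at this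

/-- **A validated grid**: every point has `-1 ≤ s_i ≤ 1`, `0 ≤ tlo_i ≤ θ_i ≤ thi_i`, `θ_i ≤ π`; the first angle is `0`, the
last is `π`; and consecutive enclosures are strictly separated. [folklore] -/
theorem gridOK_sound (h : gridOK C = true) :
    2 ≤ C.grid.length ∧
    (∀ i, i < C.grid.length →
      -1 ≤ (C.grid.getD i gridD).s ∧ (C.grid.getD i gridD).s ≤ 1 ∧ 0 ≤ (C.grid.getD i gridD).tlo ∧
      ((C.grid.getD i gridD).tlo : ℝ) ≤ (C.grid.getD i gridD).theta ∧
      (C.grid.getD i gridD).theta ≤ ((C.grid.getD i gridD).thi : ℝ) ∧ (C.grid.getD i gridD).theta ≤ Real.pi) ∧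
    (C.grid.getD 0 gridD).theta = 0 ∧ (C.grid.getD (C.grid.length - 1) gridD).theta = Real.pi ∧
    ((C.grid.getD (C.grid.length - 1) gridD).tlo = piLo) ∧
    (∀ i, i + 1 < C.grid.length → (C.grid.getD i gridD).thi < (C.grid.getD (i + 1) gridD).tlo) := by
  simp only [gridOK, Bool.and_eq_true, decide_eq_true_eq, List.all_eq_true, List.mem_range] at h
  obtain ⟨⟨⟨⟨hn, ⟨⟨h0s, h0l⟩, h0h⟩⟩, ⟨⟨hNs, hNl⟩, hNh⟩⟩, hint⟩, hsep⟩ := h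
  have hθ0 : (C.grid.getD 0 gridD).theta = 0 := by
    unfold GridPt.theta; rw [h0s]; push_cast; exact Real.arccos_one
  have hθN : (C.grid.getD (C.grid.length - 1) gridD).theta = Real.pi := by
    unfold GridPt.theta; rw [hNs]; push_cast; exact Real.arccos_neg_one
  refine ⟨hn, fun i hi => ?_, hθ0, hθN, hNl, fun i hi => hsep i (by omega)⟩
  by_cases hi0 : i = 0
  · subst hi0
    refine ⟨by rw [h0s]; norm_num, by rw [h0s], by rw [h0l], ?_, ?_, ?_⟩
    · rw [hθ0, h0l]; simp
    · rw [hθ0, h0h]; simp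
    · rw [hθ0]; exact Real.pi_pos.le
  by_cases hiN : i = C.grid.length - 1
  · subst hiN
    refine ⟨by rw [hNs], by rw [hNs]; norm_num, ?_, ?_, ?_, ?_⟩
    · rw [hNl]; unfold piLo; norm_num
    · rw [hθN, hNl]; exact piLo_lt_pi.le
    · rw [hθN, hNh]; exact pi_lt_piHi.le
    · rw [hθN]
  · have hii : i - 1 < C.grid.length - 2 := by omega
    have := hint (i - 1) hii
    rw [show i - 1 + 1 = i by omega] at this
    obtain ⟨hs1, hs2, ht0, h1, h2, _⟩ := gridPtOK_sound this
    exact ⟨hs1, hs2, ht0, h1, h2, (Real.arccos_le_pi _)⟩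

/-- The grid angles are strictly increasing in the index. [folklore] -/
theorem theta_lt_succ (h : gridOK C = true) {i : ℕ} (hi : i + 1 < C.grid.length) :
    (C.grid.getD i gridD).theta < (C.grid.getD (i + 1) gridD).theta := by
  obtain ⟨_, hpt, _, _, _, hsep⟩ := gridOK_sound C h
  have h1 := (hpt i (by omega)).2.2.2.2.1
  have h2 := (hpt (i + 1) hi).2.2.2.1
  have h3 : ((C.grid.getD i gridD).thi : ℝ) < ((C.grid.getD (i + 1) gridD).tlo : ℝ) := by exact_mod_cast hsep i hi
  linarith

/-- Monotonicity of the grid angles. [folklore] -/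
theorem theta_mono (h : gridOK C = true) {i j : ℕ} (hij : i ≤ j) (hj : j < C.grid.length) :
    (C.grid.getD i gridD).theta ≤ (C.grid.getD j gridD).theta := by
  induction j with
  | zero => simp at hij; subst hij; exact le_rfl
  | succ j ih =>
    rcases Nat.eq_or_lt_of_le hij with rfl | hlt
    · exact le_rfl
    · exact (ih (by omega) (by omega)).trans (theta_lt_succ C h hj).le

end KCert

/-- Registered sub-goal marker `stub_certMid_part13` of crux stmt-SmoothPoincare4-7631 (helper file 4-a of the kernel-clean
`stub_certMid`, line killing-flux): the zonal factor of an atom decreases in the angle. [folklore] -/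
theorem stub_certMid_part13 : ∀ (C : KCert.KCell) (a : KCert.KAtom), KCert.atomOK C a = true →
    ∀ x y : ℝ, 0 ≤ x → x ≤ y → y ≤ Real.pi → a.Zc y ≤ a.Zc x :=
  fun C _ h _ _ hx hxy hy => KCert.Zc_antitone C h hx hxy hy

end Summit.SmoothPoincare4.SmoothPoincare4.Cruxes.CylinderRungTwo.KillingFlux

end
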